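import Literature.NumberTheory.Automorphic.AdelicSchwartzBruhatLevelCriterion
import Literature.NumberTheory.Automorphic.UnitaryGroupHeisenbergBorelConj
import Literature.NumberTheory.Automorphic.FiniteAdeleSchwartzBruhatFourier
import Literature.NumberTheory.Automorphic.ReductionTheoryGLnConjugation
import HarnessLib

/-!
# The Heisenberg fibre integral of the `K`-average of a test function on `U(J₃)(𝔸_F)` satisfies the
# finite clauses of the Schwartz–Bruhat level criterion: `ψ(x₀) = ∫_{𝔸_E⁻} ∫_K f(k⁻¹ z₁ u(x₀, w) k) dk dw ∈ 𝒮(𝔸_E)`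
# modulo archimedean smoothness
(Rogawski, *Automorphic Representations of Unitary Groups in Three Variables* (1990), §7.3 pp. 96–97, (7.3.3) →
Lemma 7.1.1: the unipotent term is a Tate integral of the function `ψ` on `𝔸_E`; Weil, *Basic Number Theory*, Ch. VII
§2: standard functions)

Topic `NumberTheory/Automorphic`; namespace `Literature.NumberTheory.Automorphic.UnitaryGroup`. THEOREMS ONLY over
accepted tree modules (no definition, no named fact, no instance, no notation, no `sorry`). Row (L5-i)(E3-pre) of the
LAW 5 road of `Cruxes/H413/Lines/F0_T1InnerFormTraceIdentity.lean` (cell `pub/hodgecm-mathlib`, crux H413). Letters: the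
quasi-split `G = U(J₃)` of `E/F` (`quasiSplit F E c 3`, `hc : c * c = 1`), `N(𝔸_F) = adelicUnipotent F E c 3` with the
Heisenberg chart ★ `heisChart hc : 𝔸_E × 𝔸_E⁻ ≃ₜ N(𝔸_F)` (`𝔸_E⁻ = traceZeroAdele F E c`), a measure `μY` on `𝔸_E⁻`
invariant under left translations, a compact subgroup `K ≤ G(𝔸_F)` with any measure `μK`, a fixed `z₁ ∈ G(𝔸_F)`, and
`f : G(𝔸_F) → ℂ` of compact support, right-invariant under an open neighbourhood `U` of `1` (the level clause of ★
`IsQuasiSplitTest` ∕ `IsTestFunctionGL`).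

* §1 Heisenberg plumbing (over ★ `UnitaryGroupHeisenbergBorelConj`: `coordX_one`, `coe_coordY_one`): `heisChart_zero` (`u(0,0) = 1`), **`heisChart_add_eq_mul`** — `u(x₀ + d, w) = u(x₀, w − s) · u(d, 0)`
  with the explicit trace-zero shift `s = y(u(x₀,0) u(d,0))` (`= ½(d·c x₀ − x₀·c d)`).
* §2 A KERNEL `φ` ON `N(𝔸_F)` (any `φ : N(𝔸_F) → ℂ`): `integral_heisChart_add_eq` — if `φ(u · u(d,0)) = φ(u)` then
  `Ψ(x₀ + d) = Ψ(x₀)` for `Ψ(x₀) := ∫ φ(u(x₀, w)) dμY(w)` (Haar invariance in `w`); `exists_isCompact_integral_heisChart_ne_zero`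
  — if `φ` vanishes off a compact `S ⊆ N(𝔸_F)` then `Ψ` vanishes off a compact of `𝔸_E`; **`integral_heisChart_mem_schwartzBruhatAdele_of_contDiff`**
  — clauses (a) support and (b) level of ★ `Meyer.mem_schwartzBruhatAdele_of_level` discharged, clause (c) (smooth
  archimedean slices) kept as the hypothesis `hsm`.
* §3 THE `K`-AVERAGE KERNEL `φ(u) = ∫_K f(k⁻¹ z₁ u k) dμK`: `exists_isCompact_kAverage_ne_zero` (support, from `HasCompactSupport f`,
  `K` compact, `N(𝔸_F)` closed), `kAverage_mul_eq_of_forall_conj_mem` (level, from right-`U`-invariance once `k⁻¹ n k ∈ U` for all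
  `k ∈ K`), **`exists_levelIdeal_forall_conj_heisChart_mem`** — the tube lemma: an open `U ∋ 1` and a compact `K` admit an ideal
  `𝔫 ≠ 0` with `k⁻¹ u((0,δ),0) k ∈ U` for all `δ ∈ 𝔫𝒪̂_E`, `k ∈ K` (★ `FiniteAdeleRing.exists_forall_valued_le_idealRadius_imp_mem`).
* §4 **`integral_kAverage_heisChart_mem_schwartzBruhatAdele_of_contDiff`** — (E3-pre) modulo (c):
  `x₀ ↦ ∫_{𝔸_E⁻} ∫_K f(k⁻¹ z₁ u(x₀,w) k) dμK dμY ∈ Meyer.schwartzBruhatAdele E` as soon as its archimedean slices are smooth.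

## References

* J. D. Rogawski, *Automorphic Representations of Unitary Groups in Three Variables*, Ann. of Math. Stud. 123 (1990),
  §1.10, §7.3 (pp. 96–97) [Rogawski1990].
* A. Weil, *Basic Number Theory*, Grundlehren 144 (1967), Ch. VII §2 [WeilBNT1967].
* R. Meyer, *On a representation of the idele class group related to primes and zeros of L-functions*, Duke Math. J.
  127 (2005), §1 p. 4 [Meyer2005].
-/

set_option autoImplicit false

noncomputable section

open MeasureTheory NumberField NumberField.mixedEmbedding IsDedekindDomain Set Topology
-- `Classical` is needed to see the Mathlib normed-space instances on `mixedSpace E` (note H5 of `AdelicGLnGlue`)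
open scoped ContDiff Classical

namespace Literature.NumberTheory.Automorphic

namespace UnitaryGroup

variable {F E : Type} [Field F] [NumberField F] [Field E] [NumberField E] [Algebra F E] {c : E ≃ₐ[F] E}

/-! ## §1 Heisenberg plumbing in the chart `u(x, w)` -/

section Plumbing

/-- **`u(0, 0) = 1`.** [cite: Rogawski1990, §1.10] -/
theorem heisChart_zero (hc : c * c = 1) : heisChart hc ((0 : AdeleRing (𝓞 E) E), (0 : traceZeroAdele F E c)) = 1 := by
  have h := heisChart_coord hc (1 : adelicUnipotent F E c 3)
  have hY : coordY hc (1 : adelicUnipotent F E c 3) = 0 := Subtype.ext (coe_coordY_one hc)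
  rwa [coordX_one, hY] at h

/-- **THE HEISENBERG LAW IN THE CHART, translation in `x`**: `u(x₀ + d, w) = u(x₀, w − s) · u(d, 0)` with the trace-zero shift
`s := y(u(x₀, 0) · u(d, 0))` (`= ½ (d · c x₀ − x₀ · c d)`, independent of `w`). [cite: Rogawski1990, §1.10] -/
theorem heisChart_add_eq_mul (hc : c * c = 1) (x₀ d : AdeleRing (𝓞 E) E) (w : traceZeroAdele F E c) :
    heisChart hc (x₀ + d, w) =
      heisChart hc (x₀, w - coordY hc (heisChart hc (x₀, (0 : traceZeroAdele F E c)) * heisChart hc (d, (0 : traceZeroAdele F E c)))) *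
        heisChart hc (d, (0 : traceZeroAdele F E c)) := by
  set s := coordY hc (heisChart hc (x₀, (0 : traceZeroAdele F E c)) * heisChart hc (d, (0 : traceZeroAdele F E c))) with hs
  have hscoe : (s : AdeleRing (𝓞 E) E) = halfAdele * (d * conjAdele F E c x₀ - x₀ * conjAdele F E c d) := by
    rw [hs, coe_coordY_mul_heisChart, coordY_heisChart, coordX_heisChart]
    simp
  apply (heisChart hc).symm.injective
  rw [Homeomorph.symm_apply_apply, heisChart_symm_apply]
  refine Prod.ext ?_ (Subtype.ext ?_)
  · rw [coordX_mul_heisChart, coordX_heisChart]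
  · rw [coe_coordY_mul_heisChart, coordY_heisChart, coordX_heisChart, AddSubgroupClass.coe_sub, hscoe]
    simp

end Plumbing

/-! ## §2 A kernel on `N(𝔸_F)` integrated over the centre: support and level of `x₀ ↦ ∫ φ(u(x₀, w)) dμY(w)` -/

section Kernel

variable [MeasurableSpace (traceZeroAdele F E c)] [BorelSpace (traceZeroAdele F E c)]

/-- **LEVEL of the fibre integral**: if `φ(u · u(d, 0)) = φ(u)` for all `u ∈ N(𝔸_F)`, then `Ψ(x₀ + d) = Ψ(x₀)` for
`Ψ(x₀) = ∫ φ(u(x₀, w)) dμY(w)` — by §1 `u(x₀ + d, w) = u(x₀, w − s) u(d, 0)` and the translation invariance of `μY`.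
[cite: Rogawski1990, §7.3 (pp. 96–97)] [cite: WeilBNT1967, Ch. VII §2] -/
theorem integral_heisChart_add_eq (hc : c * c = 1) (μY : Measure (traceZeroAdele F E c)) [μY.IsAddLeftInvariant]
    {E' : Type*} [NormedAddCommGroup E'] [NormedSpace ℝ E'] {φ : adelicUnipotent F E c 3 → E'} {d : AdeleRing (𝓞 E) E}
    (hφd : ∀ u : adelicUnipotent F E c 3, φ (u * heisChart hc (d, (0 : traceZeroAdele F E c))) = φ u) (x₀ : AdeleRing (𝓞 E) E) :
    ∫ w, φ (heisChart hc (x₀ + d, w)) ∂μY = ∫ w, φ (heisChart hc (x₀, w)) ∂μY := by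
  set s := coordY hc (heisChart hc (x₀, (0 : traceZeroAdele F E c)) * heisChart hc (d, (0 : traceZeroAdele F E c))) with hs
  have h : ∀ w, φ (heisChart hc (x₀ + d, w)) = φ (heisChart hc (x₀, -s + w)) := fun w => by
    rw [heisChart_add_eq_mul hc x₀ d w, hφd, ← hs, sub_eq_neg_add]
  simp_rw [h]
  exact integral_add_left_eq_self (fun w => φ (heisChart hc (x₀, w))) (-s)

omit [BorelSpace (traceZeroAdele F E c)] in
/-- **SUPPORT of the fibre integral**: if `φ` vanishes off a compact `S ⊆ N(𝔸_F)`, then `Ψ(x₀) = ∫ φ(u(x₀, w)) dμY(w)` vanishes off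
the compact `x(S) ⊆ 𝔸_E`. [cite: WeilBNT1967, Ch. VII §2] -/
theorem integral_heisChart_ne_zero_imp_mem (hc : c * c = 1) (μY : Measure (traceZeroAdele F E c))
    {E' : Type*} [NormedAddCommGroup E'] [NormedSpace ℝ E'] {φ : adelicUnipotent F E c 3 → E'} {S : Set (adelicUnipotent F E c 3)}
    (hφS : ∀ u, φ u ≠ 0 → u ∈ S) {x₀ : AdeleRing (𝓞 E) E} (hx₀ : ∫ w, φ (heisChart hc (x₀, w)) ∂μY ≠ 0) :
    x₀ ∈ (fun u : adelicUnipotent F E c 3 => ((heisChart hc).symm u).1) '' S := by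
  by_contra hnot
  apply hx₀
  have h0 : ∀ w, φ (heisChart hc (x₀, w)) = 0 := fun w => by
    by_contra hw
    exact hnot ⟨heisChart hc (x₀, w), hφS _ hw, by
      show ((heisChart hc).symm (heisChart hc (x₀, w))).1 = x₀
      rw [Homeomorph.symm_apply_apply]⟩
  simp_rw [h0, integral_zero]

omit [MeasurableSpace (traceZeroAdele F E c)] [BorelSpace (traceZeroAdele F E c)] in
/-- The set `x(S)` of §2 is compact for compact `S`. [cite: WeilBNT1967, Ch. VII §2] -/
theorem isCompact_image_fst_heisChart_symm (hc : c * c = 1) {S : Set (adelicUnipotent F E c 3)} (hSc : IsCompact S) :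
    IsCompact ((fun u : adelicUnipotent F E c 3 => ((heisChart hc).symm u).1) '' S) :=
  hSc.image (continuous_fst.comp (heisChart hc).symm.continuous)

/-- **THE FIBRE INTEGRAL OF A KERNEL IS SCHWARTZ–BRUHAT MODULO ARCHIMEDEAN SMOOTHNESS.** Let `φ : N(𝔸_F) → ℂ` vanish off a compact
set and be right-invariant under `u((0, δ), 0)` for `δ` in a compact open subgroup `L ≤ 𝔸_E^∞`. If the archimedean slices of
`Ψ(x₀) := ∫ φ(u(x₀, w)) dμY(w)` are smooth, then `Ψ ∈ 𝒮(𝔸_E)` (★ `Meyer.mem_schwartzBruhatAdele_of_level`: clause (a) by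
`integral_heisChart_ne_zero_imp_mem`, clause (b) by `integral_heisChart_add_eq`, compact support of the slices again by (a)).
[cite: WeilBNT1967, Ch. VII §2, Def. 2 and Prop. 2] [cite: Rogawski1990, §7.3 (pp. 96–97)] -/
theorem integral_heisChart_mem_schwartzBruhatAdele_of_contDiff (hc : c * c = 1) (μY : Measure (traceZeroAdele F E c))
    [μY.IsAddLeftInvariant] {φ : adelicUnipotent F E c 3 → ℂ} {S : Set (adelicUnipotent F E c 3)} (hSc : IsCompact S)
    (hφS : ∀ u, φ u ≠ 0 → u ∈ S) {L : AddSubgroup (FiniteAdeleRing (𝓞 E) E)} (hLo : IsOpen (L : Set (FiniteAdeleRing (𝓞 E) E)))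
    (hLc : IsCompact (L : Set (FiniteAdeleRing (𝓞 E) E)))
    (hφL : ∀ δ ∈ L, ∀ u : adelicUnipotent F E c 3,
      φ (u * heisChart hc ((((0 : InfiniteAdeleRing E), δ) : AdeleRing (𝓞 E) E), (0 : traceZeroAdele F E c))) = φ u)
    (hsm : ∀ y : FiniteAdeleRing (𝓞 E) E, ContDiff ℝ ∞ fun x : mixedSpace E =>
      ∫ w, φ (heisChart hc ((((InfiniteAdeleRing.ringEquiv_mixedSpace E).symm x, y) : AdeleRing (𝓞 E) E), w)) ∂μY) :
    (fun x₀ : AdeleRing (𝓞 E) E => ∫ w, φ (heisChart hc (x₀, w)) ∂μY) ∈ Meyer.schwartzBruhatAdele E := by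
  set A := (fun u : adelicUnipotent F E c 3 => ((heisChart hc).symm u).1) '' S with hA
  have hAc : IsCompact A := isCompact_image_fst_heisChart_symm hc hSc
  have hsuppA : ∀ x₀ : AdeleRing (𝓞 E) E, (∫ w, φ (heisChart hc (x₀, w)) ∂μY) ≠ 0 → x₀ ∈ A := fun x₀ hx₀ =>
    integral_heisChart_ne_zero_imp_mem hc μY hφS hx₀
  refine Meyer.mem_schwartzBruhatAdele_of_level (hAc.image continuous_snd) (fun a ha => ⟨a, hsuppA a ha, rfl⟩) hLo hLc
    (fun x y δ hδ => ?_) hsm (fun y => ?_)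
  · have hxy : (((x, y + δ) : AdeleRing (𝓞 E) E)) = ((x, y) : AdeleRing (𝓞 E) E) + (((0 : InfiniteAdeleRing E), δ) : AdeleRing (𝓞 E) E) :=
      Prod.ext (add_zero x).symm rfl
    show (∫ w, φ (heisChart hc ((x, y + δ), w)) ∂μY) = ∫ w, φ (heisChart hc ((x, y), w)) ∂μY
    rw [hxy]
    exact integral_heisChart_add_eq hc μY (hφL δ hδ) _
  · refine HasCompactSupport.of_support_subset_isCompact
      ((hAc.image continuous_fst).image (continuous_ringEquiv_mixedSpace (K := E))) fun x hx => ?_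
    have hxA : (((InfiniteAdeleRing.ringEquiv_mixedSpace E).symm x, y) : AdeleRing (𝓞 E) E) ∈ A := hsuppA _ hx
    exact ⟨(InfiniteAdeleRing.ringEquiv_mixedSpace E).symm x, ⟨_, hxA, rfl⟩, (InfiniteAdeleRing.ringEquiv_mixedSpace E).apply_symm_apply x⟩

end Kernel

/-! ## §3 The `K`-average kernel `φ(u) = ∫_K f(k⁻¹ z₁ u k) dμK` -/

section KAverage

/-- `N(𝔸_F)` is closed in `G(𝔸_F)` (★ `isClosed_upperUnitriangular` pulled back along `adelicVal`; private plumbing).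
[cite: Rogawski1990, §1.10] -/
private theorem isClosed_adelicUnipotent_quasiSplit₃ :
    IsClosed ((adelicUnipotent F E c 3 : Set (quasiSplit F E c 3).Adelic)) := by
  haveI : T2Space (AdeleRing (𝓞 E) E) := t2Space_adeleRing E
  change IsClosed (⇑(adelicVal F E c 3 ((StdForm.antidiagonal 3).over E)) ⁻¹'
    ((upperUnitriangular (Fin 3) (AdeleRing (𝓞 E) E) : Subgroup (GL (Fin 3) (AdeleRing (𝓞 E) E))) :
      Set (GL (Fin 3) (AdeleRing (𝓞 E) E))))
  exact (isClosed_upperUnitriangular (R := AdeleRing (𝓞 E) E)).preimage continuous_subtype_val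

variable {KU : Subgroup (quasiSplit F E c 3).Adelic} [MeasurableSpace KU]

/-- **SUPPORT OF THE `K`-AVERAGE**: for `f` of compact support, `K` compact and any `z₁`, the kernel `φ(u) = ∫_K f(k⁻¹ z₁ u k) dμK`
vanishes off the compact `{u ∈ N(𝔸_F) : ∃ k ∈ K, k⁻¹ z₁ u k ∈ tsupport f} ⊆ z₁⁻¹ · K (tsupport f) K⁻¹ ∩ N(𝔸_F)` (`N(𝔸_F)` is
closed). [cite: Rogawski1990, §7.3 (pp. 96–97)] -/
theorem exists_isCompact_kAverage_ne_zero (hK : IsCompact (KU : Set (quasiSplit F E c 3).Adelic)) (μK : Measure KU)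
    (z₁ : (quasiSplit F E c 3).Adelic) {f : (quasiSplit F E c 3).Adelic → ℂ} (hf : HasCompactSupport f) :
    ∃ S : Set (adelicUnipotent F E c 3), IsCompact S ∧ ∀ u : adelicUnipotent F E c 3,
      (∫ k, f ((k : (quasiSplit F E c 3).Adelic)⁻¹ * z₁ * (u : (quasiSplit F E c 3).Adelic) * k) ∂μK) ≠ 0 → u ∈ S := by
  set S₀ : Set (quasiSplit F E c 3).Adelic :=
    (fun p : (quasiSplit F E c 3).Adelic × (quasiSplit F E c 3).Adelic => z₁⁻¹ * (p.1 * p.2 * p.1⁻¹)) ''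
      ((KU : Set (quasiSplit F E c 3).Adelic) ×ˢ tsupport f) with hS₀
  have hS₀c : IsCompact S₀ :=
    (hK.prod hf.isCompact).image ((continuous_const.mul ((continuous_fst.mul continuous_snd).mul continuous_fst.inv)))
  refine ⟨Subtype.val ⁻¹' S₀, (isClosed_adelicUnipotent_quasiSplit₃.isClosedEmbedding_subtypeVal).isCompact_preimage hS₀c,
    fun u hu => ?_⟩
  by_contra hnot
  apply hu
  have h0 : ∀ k : KU, f ((k : (quasiSplit F E c 3).Adelic)⁻¹ * z₁ * (u : (quasiSplit F E c 3).Adelic) * k) = 0 := fun k => by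
    by_contra hk
    refine hnot ⟨((k : (quasiSplit F E c 3).Adelic), (k : (quasiSplit F E c 3).Adelic)⁻¹ * z₁ * (u : (quasiSplit F E c 3).Adelic) * k),
      ⟨k.2, subset_tsupport _ hk⟩, ?_⟩
    show z₁⁻¹ * ((k : (quasiSplit F E c 3).Adelic) * ((k : (quasiSplit F E c 3).Adelic)⁻¹ * z₁ * (u : (quasiSplit F E c 3).Adelic) * k) *
      (k : (quasiSplit F E c 3).Adelic)⁻¹) = (u : (quasiSplit F E c 3).Adelic)
    group
  simp_rw [h0, integral_zero]

/-- **LEVEL OF THE `K`-AVERAGE**: if `f` is right-invariant under `U` and `k⁻¹ n k ∈ U` for all `k ∈ K`, then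
`φ(u n) = φ(u)` for the kernel `φ(u) = ∫_K f(k⁻¹ z₁ u k) dμK` (`k⁻¹ z₁ (u n) k = (k⁻¹ z₁ u k)(k⁻¹ n k)`).
[cite: Rogawski1990, §7.3 (pp. 96–97)] -/
theorem kAverage_mul_eq_of_forall_conj_mem (μK : Measure KU) (z₁ : (quasiSplit F E c 3).Adelic)
    {f : (quasiSplit F E c 3).Adelic → ℂ} {U : Set (quasiSplit F E c 3).Adelic} (hfU : ∀ g, ∀ v ∈ U, f (g * v) = f g)
    {n : (quasiSplit F E c 3).Adelic} (hn : ∀ k ∈ KU, k⁻¹ * n * k ∈ U) (u : (quasiSplit F E c 3).Adelic) :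
    (∫ k, f ((k : (quasiSplit F E c 3).Adelic)⁻¹ * z₁ * (u * n) * k) ∂μK) =
      ∫ k, f ((k : (quasiSplit F E c 3).Adelic)⁻¹ * z₁ * u * k) ∂μK := by
  refine integral_congr_ae (Filter.Eventually.of_forall fun k => ?_)
  have h : (k : (quasiSplit F E c 3).Adelic)⁻¹ * z₁ * (u * n) * k =
      ((k : (quasiSplit F E c 3).Adelic)⁻¹ * z₁ * u * k) * ((k : (quasiSplit F E c 3).Adelic)⁻¹ * n * k) := by group
  show f ((k : (quasiSplit F E c 3).Adelic)⁻¹ * z₁ * (u * n) * k) = f ((k : (quasiSplit F E c 3).Adelic)⁻¹ * z₁ * u * k)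
  rw [h, hfU _ _ (hn _ k.2)]

/-- The ideal box `𝔫𝒪̂_E` is compact (closed subgroup of the compact `𝒪̂_E`). [cite: WeilBNT1967, Ch. IV §1] -/
theorem isCompact_levelIdeal (𝔫 : Ideal (𝓞 E)) : IsCompact (levelIdeal E 𝔫 : Set (FiniteAdeleRing (𝓞 E) E)) :=
  (isCompact_integralFiniteAdeles E).of_isClosed_subset ((levelIdeal E 𝔫).isClosed_of_isOpen (isOpen_levelIdeal 𝔫))
    fun _ hx => mem_integralFiniteAdeles_of_mem_levelIdeal hx

/-- **THE TUBE LEMMA FOR THE LEVEL**: for an open `U ∋ 1` of `G(𝔸_F)` and a compact `K`, there is an ideal `𝔫 ≠ 0` of `𝓞_E`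
with `k⁻¹ · u((0, δ), 0) · k ∈ U` for every `δ ∈ 𝔫𝒪̂_E ⊆ 𝔸_E^∞` and every `k ∈ K` (`(k, δ) ↦ k⁻¹ u((0,δ),0) k` is continuous and
equals `1` at `δ = 0`; Mathlib `generalized_tube_lemma`; the ideal boxes are cofinal at `0`, ★
`FiniteAdeleRing.exists_forall_valued_le_idealRadius_imp_mem`). [cite: WeilBNT1967, Ch. VII §2] [cite: Rogawski1990, §7.3 (pp. 96–97)] -/
theorem exists_levelIdeal_forall_conj_heisChart_mem (hc : c * c = 1) {K : Set (quasiSplit F E c 3).Adelic} (hK : IsCompact K)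
    {U : Set (quasiSplit F E c 3).Adelic} (hUo : IsOpen U) (hU1 : (1 : (quasiSplit F E c 3).Adelic) ∈ U) :
    ∃ 𝔫 : Ideal (𝓞 E), 𝔫 ≠ 0 ∧ ∀ δ ∈ levelIdeal E 𝔫, ∀ k ∈ K,
      k⁻¹ * (heisChart hc ((((0 : InfiniteAdeleRing E), δ) : AdeleRing (𝓞 E) E), (0 : traceZeroAdele F E c)) :
        (quasiSplit F E c 3).Adelic) * k ∈ U := by
  set Θ : (quasiSplit F E c 3).Adelic × FiniteAdeleRing (𝓞 E) E → (quasiSplit F E c 3).Adelic := fun p =>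
    p.1⁻¹ * (heisChart hc ((((0 : InfiniteAdeleRing E), p.2) : AdeleRing (𝓞 E) E), (0 : traceZeroAdele F E c)) :
      (quasiSplit F E c 3).Adelic) * p.1 with hΘ
  have hδ : Continuous fun δ : FiniteAdeleRing (𝓞 E) E => ((((0 : InfiniteAdeleRing E), δ) : AdeleRing (𝓞 E) E)) :=
    continuous_const.prodMk continuous_id
  have hΘc : Continuous Θ := by
    refine (continuous_fst.inv.mul ?_).mul continuous_fst
    exact continuous_subtype_val.comp ((heisChart hc).continuous.comp ((hδ.comp continuous_snd).prodMk continuous_const))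
  have hsub : K ×ˢ ({0} : Set (FiniteAdeleRing (𝓞 E) E)) ⊆ Θ ⁻¹' U := by
    rintro ⟨k, δ⟩ ⟨-, hδ0⟩
    rw [mem_singleton_iff] at hδ0
    subst hδ0
    have h00 : heisChart hc ((((0 : InfiniteAdeleRing E), (0 : FiniteAdeleRing (𝓞 E) E)) : AdeleRing (𝓞 E) E),
        (0 : traceZeroAdele F E c)) = 1 := heisChart_zero hc
    have h1 : Θ (k, 0) = 1 := by
      show k⁻¹ * (heisChart hc (((((0 : InfiniteAdeleRing E), (0 : FiniteAdeleRing (𝓞 E) E)) : AdeleRing (𝓞 E) E)),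
        (0 : traceZeroAdele F E c)) : (quasiSplit F E c 3).Adelic) * k = 1
      rw [h00, OneMemClass.coe_one, mul_one, inv_mul_cancel]
    show Θ (k, 0) ∈ U
    rw [h1]
    exact hU1
  obtain ⟨u', v, -, hvo, hKu', h0v, huv⟩ := generalized_tube_lemma hK isCompact_singleton (hUo.preimage hΘc) hsub
  have hv : v ∈ 𝓝 (0 : FiniteAdeleRing (𝓞 E) E) := hvo.mem_nhds (h0v (mem_singleton 0))
  obtain ⟨𝔫, h𝔫, h𝔫v⟩ := FiniteAdeleRing.exists_forall_valued_le_idealRadius_imp_mem (K := E) hv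
  refine ⟨𝔫, h𝔫, fun δ hδL k hk => ?_⟩
  have hmem : (k, δ) ∈ Θ ⁻¹' U := huv ⟨hKu' hk, h𝔫v δ fun v => hδL v⟩
  exact hmem

end KAverage

/-! ## §4 (E3-pre) modulo archimedean smoothness -/

section Assembly

variable [MeasurableSpace (traceZeroAdele F E c)] [BorelSpace (traceZeroAdele F E c)]
  {KU : Subgroup (quasiSplit F E c 3).Adelic} [MeasurableSpace KU]

/-- **`ψ ∈ 𝒮(𝔸_E)` MODULO ARCHIMEDEAN SMOOTHNESS** (Rogawski (1990), §7.3 pp. 96–97: the function `ψ` of the unipotent term). For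
`f : G(𝔸_F) → ℂ` of compact support, right-invariant under an open `U ∋ 1` (the level clause of a test function), a compact subgroup
`K` with any measure `μK`, any `z₁ ∈ G(𝔸_F)` and any left-invariant measure `μY` on `𝔸_E⁻`, the function
`ψ(x₀) := ∫_{𝔸_E⁻} ∫_K f(k⁻¹ z₁ u(x₀, w) k) dμK dμY` lies in ★ `Meyer.schwartzBruhatAdele E` as soon as its archimedean slices
`x_∞ ↦ ψ(x_∞, y)` are smooth (`hsm`, clause (c) — the one analytic input left to the (E) assembly). Composition: §3 support + tube
lemma + level, §2. [cite: Rogawski1990, §7.3 (pp. 96–97)] [cite: WeilBNT1967, Ch. VII §2, Def. 2 and Prop. 2] [cite: Meyer2005, §1 p. 4] -/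
theorem integral_kAverage_heisChart_mem_schwartzBruhatAdele_of_contDiff (hc : c * c = 1) (μY : Measure (traceZeroAdele F E c))
    [μY.IsAddLeftInvariant] (hK : IsCompact (KU : Set (quasiSplit F E c 3).Adelic)) (μK : Measure KU) (z₁ : (quasiSplit F E c 3).Adelic)
    {f : (quasiSplit F E c 3).Adelic → ℂ} (hf : HasCompactSupport f) {U : Set (quasiSplit F E c 3).Adelic} (hUo : IsOpen U)
    (hU1 : (1 : (quasiSplit F E c 3).Adelic) ∈ U) (hfU : ∀ g, ∀ v ∈ U, f (g * v) = f g)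
    (hsm : ∀ y : FiniteAdeleRing (𝓞 E) E, ContDiff ℝ ∞ fun x : mixedSpace E =>
      ∫ w, (∫ k, f ((k : (quasiSplit F E c 3).Adelic)⁻¹ * z₁ *
        (heisChart hc ((((InfiniteAdeleRing.ringEquiv_mixedSpace E).symm x, y) : AdeleRing (𝓞 E) E), w) : (quasiSplit F E c 3).Adelic) * k) ∂μK) ∂μY) :
    (fun x₀ : AdeleRing (𝓞 E) E => ∫ w, (∫ k, f ((k : (quasiSplit F E c 3).Adelic)⁻¹ * z₁ *
      (heisChart hc (x₀, w) : (quasiSplit F E c 3).Adelic) * k) ∂μK) ∂μY) ∈ Meyer.schwartzBruhatAdele E := by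
  obtain ⟨S, hSc, hS⟩ := exists_isCompact_kAverage_ne_zero hK μK z₁ hf
  obtain ⟨𝔫, -, h𝔫⟩ := exists_levelIdeal_forall_conj_heisChart_mem hc hK hUo hU1
  refine integral_heisChart_mem_schwartzBruhatAdele_of_contDiff hc μY
    (φ := fun u : adelicUnipotent F E c 3 => ∫ k, f ((k : (quasiSplit F E c 3).Adelic)⁻¹ * z₁ * (u : (quasiSplit F E c 3).Adelic) * k) ∂μK)
    hSc hS (isOpen_levelIdeal 𝔫) (isCompact_levelIdeal 𝔫) (fun δ hδ u => ?_) hsm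
  show (∫ k, f ((k : (quasiSplit F E c 3).Adelic)⁻¹ * z₁ * ((u : (quasiSplit F E c 3).Adelic) *
      (heisChart hc ((((0 : InfiniteAdeleRing E), δ) : AdeleRing (𝓞 E) E), (0 : traceZeroAdele F E c)) : (quasiSplit F E c 3).Adelic)) * k) ∂μK) =
    ∫ k, f ((k : (quasiSplit F E c 3).Adelic)⁻¹ * z₁ * (u : (quasiSplit F E c 3).Adelic) * k) ∂μK
  exact kAverage_mul_eq_of_forall_conj_mem μK z₁ hfU (h𝔫 δ hδ) _

end Assembly

end UnitaryGroup

end Literature.NumberTheory.Automorphic
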